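import Summits.QuantumFields.YangMills.Theorems.BalabanUVNodesN19UniformMomentsChebyshevRoadPoisson

/-!
# YM-DAG node N19 (= NE7 proper) — FIXED OBSERVABLES UNDER THE UNIFORM-MOMENT CURRENCY, VIII: AT THE TORUS SCHEME — under matching of EVERY power of a
# string with geometric remainder, Chebyshev-summable observables of the string (e.g. the Poisson observables) converge ABSOLUTELY

Cell `pub-ymgap`, HUMAN RULING D-0062 (Track A) ∕ D-0149 (work-bound push), R141 (C) wider-strategy seat `pub-ymgap-dag-n19-e` (strategy s3 =
ALTERNATIVE CURRENCY), generation g24, module 8 (lineage module 92; the scheme face of modules 90∕91).  Route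
`Summits/QuantumFields/YangMills/Theses/BalabanUVNodes.lean` rev 25, cluster item K3⁷ «SpineGivenEndpointR13SepCoPH» (stmt-QuantumFields-20544); filed
`--supports` that item `--as helper` (it proves no registered stub).  COUNT-NEUTRAL: bookkeeping over module 78 (`uniformMoments_step_of_matchingModConstants_pow`:
the one-step price of every power of a string, uniform in the order), module 64 (`law_prodObs_Icc_compl`), modules 90∕91 BY NAME, Mathlib (`posLog_mul`,
`posLog_pow`, `hasSum_coe_mul_geometric_of_norm_lt_one`); the scheme object enters only through those cited faces; N19's DECL target is a HYPOTHESIS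
(`Spine.NE7.Target` for every power of the string); no Theses import; NOT a discharge claim.

§1 THE LIN-LOG GEOMETRIC REMAINDER IS GEOMETRIC AT `√θ`: for `δ_K = Cθ^K` (`C > 0`, `0 < θ < 1`, `vol ≥ 0`) the uniform moment closeness of module 78,
`r_K = (8e^{1+l₀}∕l₀)·vol·δ_K·(1 + log⁺(2vol·δ_K)⁻¹)`, satisfies `r_K ≤ C′·(√θ)^K` with `C′ = (8e^{1+l₀}∕l₀)·vol·C·(1 + log⁺(2volC)⁻¹ + log θ⁻¹)∕(1 − √θ)² + 1`
(`log⁺` is subadditive, `(K+1)(√θ)^K ≤ Σ_n(n+1)(√θ)^n = 1∕(1−√θ)²`).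
§2 ★ `summable_abs_increments_chebyshevObs_of_matchingModConstants_pow`: at the torus scheme, IF every power `os^k` of a string matches modulo constants
with remainder `Cθ^K` at radius `l₀ > 0`, THEN for every observable `g = Σ_j a_j T_j` of the string variable `∏os ∈ [−1,1]` with `Σ|a_j| < ∞`, `Σ j|a_j| < ∞`
the expectations `K ↦ ∫ g(∏os) dgibbs_K` have ABSOLUTELY summable increments (module 90 at the laws of `∏os`, closeness `C′(√θ)^K`); ★
`summable_abs_increments_poissonObs_of_uniformTarget`: under UNIFORM `Spine.NE7.Target vol l₀ (Cθ^·)` (every string) the Poisson observables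
`(1 − q∏os)∕(1 − 2q∏os + q²)` (`|q| < 1`) converge absolutely.  Compare module 84 (polynomial observables under the WINDOW target) and module 83 (one
Lipschitz observable with `Σ = ∞` there): under the uniform target the absolutely convergent class provably contains every Chebyshev-summable observable
with `Σ j|a_j| < ∞`, along the scheme's OWN sequence (no arc chain involved).

HONEST FRAMING (binding).  Bookkeeping over cited faces; the matching hypotheses are N19-type TARGET SHAPES assumed, not proved; nothing of Bałaban's
instantiated; NE7 NOT PRINTED, NOT proved; N19 NOT discharged; count-neutral.  One finite `T⁴` programme at fixed `ε`; nothing continuum ∕ `ℝ⁴` ∕ OS ∕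
mass-gap ∕ Clay.  0 `def` ∕ 0 `sorry`.
-/

noncomputable section

open Real Finset MeasureTheory ProbabilityTheory Polynomial Polynomial.Chebyshev

namespace Summit.QuantumFields.YangMills.Theorems.BalabanUVNodesN19UniformTargetChebyshevObservables

open Literature.MathematicalPhysics.QuantumFieldTheory.Balaban1983to89
open T4GenFunBounds (prodObs gibbsMeasure schemeZ)
open T4CauchySum (MatchingModConstants)
open Missing (TorusScheme)
open Summit.QuantumFields.BalabanUV.T4Continuum.Spine
open Summit.QuantumFields.YangMills.Theorems.BalabanUVNodesN19UniformMomentSummabilityThreshold (uniformMoments_step_of_matchingModConstants_pow)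
open Summit.QuantumFields.YangMills.Theorems.BalabanUVNodesN19LawIncrementsTarget (law_prodObs_Icc_compl)
open Summit.QuantumFields.YangMills.Theorems.BalabanUVNodesN19UniformMomentsChebyshevRoad (summable_abs_increments_of_chebyshev)
open Summit.QuantumFields.YangMills.Theorems.BalabanUVNodesN19UniformMomentsChebyshevRoadPoisson (hasSum_pow_mul_T summable_abs_increments_poissonObs)

/-! ## §1 The lin-log geometric remainder is geometric at ratio `√θ` [folklore] -/

/-- `(K+1)ρ^K ≤ 1∕(1−ρ)²` for `0 ≤ ρ < 1` (one term of `Σ_n (n+1)ρ^n = 1∕(1−ρ)²`). [folklore] -/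
theorem succ_mul_pow_le {ρ : ℝ} (hρ0 : 0 ≤ ρ) (hρ1 : ρ < 1) (K : ℕ) : ((K : ℝ) + 1) * ρ ^ K ≤ 1 / (1 - ρ) ^ 2 := by
  have hρn : ‖ρ‖ < 1 := by rwa [Real.norm_eq_abs, abs_of_nonneg hρ0]
  have h1 : HasSum (fun n : ℕ => (n : ℝ) * ρ ^ n) (ρ / (1 - ρ) ^ 2) := hasSum_coe_mul_geometric_of_norm_lt_one hρn
  have h2 : HasSum (fun n : ℕ => ρ ^ n) (1 - ρ)⁻¹ := hasSum_geometric_of_lt_one hρ0 hρ1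
  have h3 : HasSum (fun n : ℕ => ((n : ℝ) + 1) * ρ ^ n) (ρ / (1 - ρ) ^ 2 + (1 - ρ)⁻¹) := by
    have h := h1.add h2
    have e : (fun n : ℕ => (n : ℝ) * ρ ^ n + ρ ^ n) = fun n : ℕ => ((n : ℝ) + 1) * ρ ^ n := by funext n; ring
    rw [e] at h
    exact h
  have h4 : ρ / (1 - ρ) ^ 2 + (1 - ρ)⁻¹ = 1 / (1 - ρ) ^ 2 := by
    have : (1 - ρ) ≠ 0 := by linarith
    field_simp
    ring
  rw [← h4]
  exact le_hasSum h3 K fun n _ => by positivity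

/-- ★ **THE LIN-LOG GEOMETRIC REMAINDER IS GEOMETRIC AT `√θ`.**  For `C > 0`, `0 < θ < 1`, `vol ≥ 0`, `A ≥ 0` and every `K`:
`A·(vol·(Cθ^K))·(1 + log⁺(2·(vol·(Cθ^K)))⁻¹) ≤ (A·vol·C·(1 + log⁺(2volC)⁻¹ + log θ⁻¹)∕(1−√θ)²)·(√θ)^K`. [folklore] -/
theorem linlog_geometric_le_sqrt_geometric {A vol C θ : ℝ} (hA : 0 ≤ A) (hvol : 0 ≤ vol) (hC : 0 < C) (hθ0 : 0 < θ) (hθ1 : θ < 1) (K : ℕ) :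
    A * (vol * (C * θ ^ K)) * (1 + Real.posLog (2 * (vol * (C * θ ^ K)))⁻¹) ≤
      (A * vol * C * (1 + Real.posLog (2 * vol * C)⁻¹ + Real.log θ⁻¹) / (1 - Real.sqrt θ) ^ 2) * Real.sqrt θ ^ K := by
  set lam : ℝ := Real.log θ⁻¹ with hlam
  have hlam_pos : 0 < lam := Real.log_pos ((one_lt_inv₀ hθ0).2 hθ1)
  set L₀ : ℝ := Real.posLog (2 * vol * C)⁻¹ with hL₀
  have hL₀0 : 0 ≤ L₀ := Real.posLog_nonneg
  set ρ : ℝ := Real.sqrt θ with hρ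
  have hρ0 : 0 < ρ := Real.sqrt_pos.2 hθ0
  have hρ1 : ρ < 1 := by rw [hρ, Real.sqrt_lt' one_pos]; simpa using hθ1
  have hρsq : ρ ^ 2 = θ := Real.sq_sqrt hθ0.le
  -- the log factor: `1 + log⁺(2volCθ^K)⁻¹ ≤ (1 + L₀ + lam)(K+1)`
  have hlog : 1 + Real.posLog (2 * (vol * (C * θ ^ K)))⁻¹ ≤ (1 + L₀ + lam) * ((K : ℝ) + 1) := by
    have e : (2 * (vol * (C * θ ^ K)))⁻¹ = (2 * vol * C)⁻¹ * (θ⁻¹) ^ K := by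
      rw [inv_pow]; field_simp
    rw [e]
    have h1 := Real.posLog_mul (x := (2 * vol * C)⁻¹) (y := (θ⁻¹) ^ K)
    have hθinv : Real.posLog θ⁻¹ = lam := by
      rw [hlam]; exact Real.posLog_eq_log (by rw [abs_of_pos (inv_pos.2 hθ0)]; exact (one_le_inv₀ hθ0).2 hθ1.le)
    rw [Real.posLog_pow, hθinv] at h1
    have hK0 : (0 : ℝ) ≤ K := Nat.cast_nonneg K
    nlinarith [mul_nonneg hL₀0 hK0, mul_nonneg hlam_pos.le hK0]
  -- `θ^K (K+1) = ρ^K · ((K+1)ρ^K) ≤ ρ^K∕(1−ρ)²`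
  have hpow : θ ^ K * ((K : ℝ) + 1) ≤ ρ ^ K * (1 / (1 - ρ) ^ 2) := by
    rw [← hρsq, ← pow_mul, mul_comm 2 K, pow_mul, sq, mul_assoc]
    exact mul_le_mul_of_nonneg_left (by rw [mul_comm]; exact succ_mul_pow_le hρ0.le hρ1 K) (pow_nonneg hρ0.le K)
  have hpos1 : 0 ≤ A * (vol * C) := mul_nonneg hA (mul_nonneg hvol hC.le)
  calc A * (vol * (C * θ ^ K)) * (1 + Real.posLog (2 * (vol * (C * θ ^ K)))⁻¹)
      ≤ A * (vol * (C * θ ^ K)) * ((1 + L₀ + lam) * ((K : ℝ) + 1)) :=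
        mul_le_mul_of_nonneg_left hlog (by positivity)
    _ = A * (vol * C) * (1 + L₀ + lam) * (θ ^ K * ((K : ℝ) + 1)) := by ring
    _ ≤ A * (vol * C) * (1 + L₀ + lam) * (ρ ^ K * (1 / (1 - ρ) ^ 2)) :=
        mul_le_mul_of_nonneg_left hpow (mul_nonneg hpos1 (by positivity))
    _ = (A * vol * C * (1 + L₀ + lam) / (1 - ρ) ^ 2) * ρ ^ K := by
        have : (1 - ρ) ≠ 0 := by linarith
        field_simp

/-! ## §2 At the torus scheme [bookkeeping] -/

section Scheme

variable {G : Type*} [GaugeGroup G] [MeasurableSpace G] [RegularGaugeGroup G] [HaarData G] {O : Type*}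
  (S : TorusScheme G O) (hβ : ∀ K, 0 ≤ S.β K) (hm : ∀ K o, Measurable (S.obs K o)) (h1 : ∀ K o U, |S.obs K o U| ≤ 1)
include hβ hm h1

/-- ★ **CHEBYSHEV-SUMMABLE OBSERVABLES OF A STRING CONVERGE ABSOLUTELY UNDER MATCHING OF EVERY POWER WITH GEOMETRIC REMAINDER** [bookkeeping].
IF every power `os^k` (`(List.replicate k os).flatten`) matches modulo constants with remainder `Cθ^K` (`C > 0`, `0 < θ < 1`) at radius `l₀ > 0`, volume
factor `vol ≥ 0`, THEN for every `g = Σ_j a_j T_j` on `[−1,1]` with `Σ|a_j| < ∞` and `Σ j|a_j| < ∞` the increments of `K ↦ ∫ g(∏os) dgibbs_K` are summable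
(module 78's uniform one-step price is `≤ C′(√θ)^K` by §1; module 90 at the laws of `∏os`). -/
theorem summable_abs_increments_chebyshevObs_of_matchingModConstants_pow {vol l₀ C θ : ℝ} (hvol : 0 ≤ vol) (hl₀ : 0 < l₀)
    (hC : 0 < C) (hθ0 : 0 < θ) (hθ1 : θ < 1) (os : List O)
    (hM : ∀ k : ℕ, MatchingModConstants vol l₀ (fun K => C * θ ^ K) (schemeZ S (List.replicate k os).flatten))
    {g : ℝ → ℝ} (hgmeas : Measurable g) {a : ℕ → ℝ} (ha : Summable fun j => |a j|) (ha1 : Summable fun j => j * |a j|)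
    (hg : ∀ x ∈ Set.Icc (-1 : ℝ) 1, HasSum (fun j => a j * (T ℝ j).eval x) (g x)) :
    Summable fun K => |∫ U, g (prodObs S (K + 1) os U) ∂gibbsMeasure (S.P (K + 1)) (S.β (K + 1)) -
      ∫ U, g (prodObs S K os U) ∂gibbsMeasure (S.P K) (S.β K)| := by
  haveI hP : ∀ K, IsProbabilityMeasure (gibbsMeasure (G := G) (S.P K) (S.β K)) := fun K =>
    T4GenFunBounds.isProbabilityMeasure_gibbsMeasure (G := G) (S.P K) (hβ K)
  have hmeas : ∀ K, AEMeasurable (prodObs S K os) (gibbsMeasure (S.P K) (S.β K)) := fun K =>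
    (T4GenFunBounds.measurable_prodObs S hm K os).aemeasurable
  haveI : ∀ K, IsProbabilityMeasure ((gibbsMeasure (S.P K) (S.β K)).map (prodObs S K os)) := fun K =>
    Measure.isProbabilityMeasure_map (hmeas K)
  have hint : ∀ (K : ℕ) {f : ℝ → ℝ}, Measurable f →
      ∫ x, f x ∂((gibbsMeasure (S.P K) (S.β K)).map (prodObs S K os)) = ∫ U, f (prodObs S K os U) ∂gibbsMeasure (S.P K) (S.β K) :=
    fun K f hf => integral_map (hmeas K) hf.aestronglyMeasurable
  -- the uniform moment closeness at the scheme, then geometric at ratio `√θ`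
  have hρ0 : 0 < Real.sqrt θ := Real.sqrt_pos.2 hθ0
  have hρ1 : Real.sqrt θ < 1 := by rw [Real.sqrt_lt' one_pos]; simpa using hθ1
  have hA : 0 ≤ 8 * Real.exp (1 + l₀) / l₀ := by positivity
  have hlam : 0 ≤ Real.log θ⁻¹ := (Real.log_pos ((one_lt_inv₀ hθ0).2 hθ1)).le
  have hD : 0 ≤ 8 * Real.exp (1 + l₀) / l₀ * vol * C * (1 + Real.posLog (2 * vol * C)⁻¹ + Real.log θ⁻¹) / (1 - Real.sqrt θ) ^ 2 :=
    div_nonneg (mul_nonneg (mul_nonneg (mul_nonneg hA hvol) hC.le)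
      (by linarith [Real.posLog_nonneg (x := (2 * vol * C)⁻¹)])) (sq_nonneg _)
  have hC'pos : 0 < 8 * Real.exp (1 + l₀) / l₀ * vol * C * (1 + Real.posLog (2 * vol * C)⁻¹ + Real.log θ⁻¹) / (1 - Real.sqrt θ) ^ 2 + 1 := by
    linarith
  have hmom : ∀ K j : ℕ, |∫ x, x ^ j ∂((gibbsMeasure (S.P (K + 1)) (S.β (K + 1))).map (prodObs S (K + 1) os)) -
      ∫ x, x ^ j ∂((gibbsMeasure (S.P K) (S.β K)).map (prodObs S K os))| ≤
      (8 * Real.exp (1 + l₀) / l₀ * vol * C * (1 + Real.posLog (2 * vol * C)⁻¹ + Real.log θ⁻¹) / (1 - Real.sqrt θ) ^ 2 + 1) *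
        Real.sqrt θ ^ K := by
    intro K j
    rw [hint (K + 1) (continuous_pow j).measurable, hint K (continuous_pow j).measurable]
    refine (uniformMoments_step_of_matchingModConstants_pow S hβ hm h1 hl₀ os hM K j).trans ?_
    refine (linlog_geometric_le_sqrt_geometric hA hvol hC hθ0 hθ1 K).trans ?_
    have hx : 0 ≤ Real.sqrt θ ^ K := pow_nonneg (Real.sqrt_nonneg θ) K
    rw [add_mul, one_mul]
    linarith
  have h := summable_abs_increments_of_chebyshev (Λ := fun K => (gibbsMeasure (S.P K) (S.β K)).map (prodObs S K os))
    (fun K => law_prodObs_Icc_compl S hm h1 K os) hC'pos hρ0 hρ1 hmom ha ha1 hg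
  have e : ∀ K : ℕ, |∫ x, g x ∂((gibbsMeasure (S.P (K + 1)) (S.β (K + 1))).map (prodObs S (K + 1) os)) -
      ∫ x, g x ∂((gibbsMeasure (S.P K) (S.β K)).map (prodObs S K os))| =
      |∫ U, g (prodObs S (K + 1) os U) ∂gibbsMeasure (S.P (K + 1)) (S.β (K + 1)) -
        ∫ U, g (prodObs S K os U) ∂gibbsMeasure (S.P K) (S.β K)| := fun K => by
    rw [hint (K + 1) hgmeas, hint K hgmeas]
  exact (summable_congr e).1 h.1

/-- ★ **UNDER UNIFORM `Target` AT GEOMETRIC REMAINDERS THE POISSON OBSERVABLES OF EVERY STRING CONVERGE ABSOLUTELY** [bookkeeping]: from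
`∀ os', Spine.NE7.Target vol l₀ (K ↦ Cθ^K) (schemeZ S os')` (N19's DECL target for every string — a HYPOTHESIS), for every string `os` and `|q| < 1` the
increments of `K ↦ ∫ (1 − q∏os)∕(1 − 2q∏os + q²) dgibbs_K` are summable (module 91's generating function `Σ q^jT_j`). -/
theorem summable_abs_increments_poissonObs_of_uniformTarget {vol l₀ C θ : ℝ} (hvol : 0 ≤ vol) (hl₀ : 0 < l₀)
    (hC : 0 < C) (hθ0 : 0 < θ) (hθ1 : θ < 1)
    (hT : ∀ os' : List O, NE7.Target vol l₀ (fun K => C * θ ^ K) (schemeZ S os')) (os : List O) {q : ℝ} (hq : |q| < 1) :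
    Summable fun K => |∫ U, (1 - q * prodObs S (K + 1) os U) / (1 - 2 * q * prodObs S (K + 1) os U + q ^ 2) ∂gibbsMeasure (S.P (K + 1)) (S.β (K + 1)) -
      ∫ U, (1 - q * prodObs S K os U) / (1 - 2 * q * prodObs S K os U + q ^ 2) ∂gibbsMeasure (S.P K) (S.β K)| := by
  have ha : Summable fun j : ℕ => |q ^ j| := by
    simp_rw [abs_pow]; exact summable_geometric_of_lt_one (abs_nonneg q) hq
  have ha1 : Summable fun j : ℕ => (j : ℝ) * |q ^ j| := by
    simp_rw [abs_pow]
    have h := summable_pow_mul_geometric_of_norm_lt_one 1 (show ‖|q|‖ < 1 by rwa [Real.norm_eq_abs, abs_abs])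
    simpa only [pow_one] using h
  have hgmeas : Measurable fun x : ℝ => (1 - q * x) / (1 - 2 * q * x + q ^ 2) := by fun_prop
  have hM : ∀ k : ℕ, MatchingModConstants vol l₀ (fun K => C * θ ^ K) (schemeZ S (List.replicate k os).flatten) := fun k => (hT _).1
  have h := summable_abs_increments_chebyshevObs_of_matchingModConstants_pow S hβ hm h1 hvol hl₀ hC hθ0 hθ1 os hM
    hgmeas ha ha1 (fun x hx => hasSum_pow_mul_T hq hx)
  exact h

end Scheme

end Summit.QuantumFields.YangMills.Theorems.BalabanUVNodesN19UniformTargetChebyshevObservables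

end
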